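import Mathlib.AlgebraicGeometry.AlgClosed.Basic
import Mathlib.AlgebraicGeometry.Morphisms.UnderlyingMap
import Mathlib.AlgebraicGeometry.Noetherian
import HarnessLib

/-!
# Geometric points lift along surjective morphisms locally of finite type

Layer `Literature/AlgebraicGeometry/Morphisms`, namespace `Literature.AlgebraicGeometry.Morphisms`.  THEOREMS ONLY (no
definition, no named fact, no instance).

[GortzWedhorn2020] Prop. 4.8 / Exercise 4.11 with Cor. 3.36 (Hilbert's Nullstellensatz: over an algebraically closed field
`Ω`, the closed points of a scheme locally of finite type are its `Ω`-valued points) and EGA I (3.5.3) («un morphisme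
`f : X → Y` est surjectif si et seulement si, pour tout corps `K` algébriquement clos, `X(K) → Y(K)` est surjectif»; the
easy direction is all that is proved here): for a SURJECTIVE morphism `f : X → Y` LOCALLY OF FINITE TYPE and an
algebraically closed field `Ω`, every `Ω`-point `y : Spec Ω → Y` lifts to an `Ω`-point `x : Spec Ω → X` with `x ≫ f = y`.
Proof: the base change `X_y := X ×_Y Spec Ω → Spec Ω` is surjective and locally of finite type, hence `X_y` is a non-empty
Jacobson scheme; a closed point of `X_y` is an `Ω`-point over `Spec Ω` (Mathlib `AlgebraicGeometry.pointOfClosedPoint`),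
and its composite with `X_y → X` is the lift.

* `exists_comp_eq_of_surjective` — the lift; `exists_over_comp_eq_of_surjective` — the same for morphisms OVER a base
  `S` (`Over.mk s ⟶ X` for a field-valued point `s : Spec Ω → S`), the currency of sections-on-fibres of abelian schemes
  (`AbelianSchemeOver.FibrePoints`): consumer = «`ψ : A → A/K` is onto on geometric fibres» (cell `hodgecm-mathlib`,
  HECKE-LINK line, file (i) `AbelianSchemeConstSubgroupQuotient` socket `SocketOntoFibres`, and the hypothesis of
  `AbelianSchemes/LevelStructureOfIsogeny`).

Presearch: the `ℂ`-points-of-`ℂ`-schemes form is ★ `Motives.FiniteQuotient.map_mk_surjective` and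
★ `Motives.FiberBaseChange.exists_algPoints_over_of_isClosed`; the form over an arbitrary base with arbitrary algebraically
closed `Ω` was absent (`rg "\[Surjective" … | rg "IsAlgClosed"` = 0).  HC_CM is proved only modulo the 7 printed citations
until rung 0 closes — this file asserts nothing about HC.

## References
* U. Görtz, T. Wedhorn, *Algebraic Geometry I*, 2nd ed. (2020), Cor. 3.36 (p. 83), Prop. 4.8 (p. 98). [GortzWedhorn2020]
* A. Grothendieck, J. Dieudonné, *Éléments de géométrie algébrique* I (Publ. Math. IHÉS 4, 1960), (3.5.3) (the surjectivity criterion; not a tree bib key, cited in prose only).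
-/

noncomputable section

universe u

open CategoryTheory CategoryTheory.Limits AlgebraicGeometry

namespace Literature.AlgebraicGeometry.Morphisms

/-- **Geometric points lift along surjective morphisms locally of finite type**: for `f : X → Y` surjective and
locally of finite type and `Ω` algebraically closed, every `y : Spec Ω → Y` is `x ≫ f` for some `x : Spec Ω → X` (a
closed point of the non-empty Jacobson scheme `X ×_Y Spec Ω`, read as an `Ω`-point by the Nullstellensatz).
[cite: GortzWedhorn2020, Cor. 3.36 (p. 83) and Prop. 4.8 (p. 98)] -/
theorem exists_comp_eq_of_surjective {X Y : Scheme.{u}} (f : X ⟶ Y) [Surjective f] [LocallyOfFiniteType f]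
    {Ω : Type u} [Field Ω] [IsAlgClosed Ω] (y : Spec (.of Ω) ⟶ Y) :
    ∃ x : Spec (.of Ω) ⟶ X, x ≫ f = y := by
  let g : pullback f y ⟶ Spec (.of Ω) := pullback.snd f y
  haveI : JacobsonSpace ↑(pullback f y) := LocallyOfFiniteType.jacobsonSpace g
  -- the base change is surjective onto `Spec Ω`, hence non-empty
  obtain ⟨z, -⟩ := g.surjective (IsLocalRing.closedPoint Ω)
  -- a closed point of the Jacobson scheme `X ×_Y Spec Ω`
  obtain ⟨a, -, hac⟩ := nonempty_inter_closedPoints (Z := (Set.univ : Set ↑(pullback f y))) ⟨z, trivial⟩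
    isClosed_univ.isLocallyClosed
  -- … is an `Ω`-point over `Spec Ω`
  refine ⟨pointOfClosedPoint g a (mem_closedPoints_iff.mp hac) ≫ pullback.fst f y, ?_⟩
  rw [Category.assoc, pullback.condition, ← Category.assoc, pointOfClosedPoint_comp, Category.id_comp]

/-- **The same OVER A BASE**: for `S`-schemes `X → S`, `Y → S`, an `S`-morphism `u : X → Y` whose underlying map is
surjective and locally of finite type, a field-valued point `s : Spec Ω → S` with `Ω` algebraically closed and a point
`y : Spec Ω → Y` OVER `s`, there is a point `x : Spec Ω → X` over `s` with `x ≫ u = y` (as `S`-morphisms out of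
`Over.mk s`). [cite: GortzWedhorn2020, Cor. 3.36 (p. 83) and Prop. 4.8 (p. 98)] -/
theorem exists_over_comp_eq_of_surjective {S : Scheme.{u}} {X Y : Over S} (u : X ⟶ Y) [Surjective u.left]
    [LocallyOfFiniteType u.left] {Ω : Type u} [Field Ω] [IsAlgClosed Ω] (s : Spec (.of Ω) ⟶ S)
    (y : Over.mk s ⟶ Y) : ∃ x : Over.mk s ⟶ X, x ≫ u = y := by
  obtain ⟨x₀, hx₀⟩ := exists_comp_eq_of_surjective u.left y.left
  have hx : x₀ ≫ X.hom = s := by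
    rw [← Over.w u, ← Category.assoc, hx₀]
    exact Over.w y
  exact ⟨Over.homMk x₀ hx, Over.OverMorphism.ext hx₀⟩

end Literature.AlgebraicGeometry.Morphisms

end
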